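import Summits.ValiantsHypothesis.ValiantsHypothesis.Theses.IntegralOrbits
import Literature.Computability.AlgebraicComplexity.TauConjectureDischarge
import Summits.ValiantsHypothesis.ValiantsHypothesis.Theorems.IntegralOrbitsTauBurgisserDetStubTauDetCF
import Summits.ValiantsHypothesis.ValiantsHypothesis.Theorems.IntegralOrbitsTauBurgisserDetStubPerBitsQP
import Summits.ValiantsHypothesis.ValiantsHypothesis.Theorems.IntegralOrbitsTauBurgisserDetStubChCollapseQP
import Summits.ValiantsHypothesis.ValiantsHypothesis.Theorems.IntegralOrbitsTauBurgisserDetStubTauEndgame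
import Summits.ValiantsHypothesis.ValiantsHypothesis.Theorems.IntegralOrbitsTauBurgisserDetStubTransferWitness
import Summits.ValiantsHypothesis.ValiantsHypothesis.Theorems.IntegralOrbitsTauBurgisserDetStubTransferCore
import Summits.ValiantsHypothesis.ValiantsHypothesis.Theorems.IntegralOrbitsTauBurgisserDetStubTransferQP

/-!
# `TauBurgisserDet` — Bürgisser's transfer theorem at quasi-polynomial granularity, with powers and a multiplier

Route `route-ValiantsHypothesis-IntegralOrbits`, crux item `stmt-ValiantsHypothesis-7680`, decl
`Summit.ValiantsHypothesis.ValiantsHypothesis.Theses.IntegralOrbits.TauBurgisserDet`: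

  the Shub–Smale τ-conjecture (`TauConjecture`, verbatim) implies that there are NO `c, n₀` such that for all
  `n ≥ n₀` some `N · per_n^d` (`N ≠ 0`, `d ≥ 1`) is the determinant of an `m × m` matrix of affine forms over `ℤ`
  with all coefficients in `{−1, 0, 1}` and `m ≤ 2^((log₂ n + c)^c)` ("SignDetQP").

This is Bürgisser 2009, Thm. 1.1(2) / Main Thm. 1.2 (τ-conjecture ⇒ τ(PER) superpolynomial) RE-RUN at
quasi-polynomial granularity with powers and an integer multiplier, assembled (line `registered` of the crux
chain, lead prover) from seven landed stubs:

* `stub_tauDetCF` — `τ(DET_m) = m^{O(1)}` for the CONSTANT-FREE measure (Berkowitz);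
* `stub_perBitsQP` — Lemma 2.12_qp: SignDetQP ⇒ `PP ⊆ qpSIZE` (Boolean side: `N² 2^{2pd} cnt^{2d}` decided by a threshold);
* `stub_chCollapseQP` — Lemma 2.5(2)_qp: `PP ⊆ qpSIZE ⇒ CH ⊆ qpSIZE` (qp ∘ qp = qp);
* `stub_transferWitness` — Thm. 2.11 (Koiran's criterion) for TWO qp-size predicates at once, SIGNED: one constant-free
  circuit whose Boolean sum is `B⁺_n − B⁻_n`;
* `stub_transferCore` — Thm. 2.10 at explicit size + SignDetQP at the padded dimension + the constant-free determinant: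
  `τ(N · (2^e · Σ_e P)^d) ≤ qp`;
* `stub_transferQP` — Thm. 4.1(2)_qp with powers and multiplier (assembly + bookkeeping): for `b` definable in `CH`,
  `τ(N · (2^e · Σ_k b(n,k) X^k)^d) ≤ 2^((log log n + c)^c)` for all large `n`;
* `stub_tauEndgame` — the root count: with Cor. 3.9 (`Burgisser2009_pochhammerWilkinson_coeff_chDefinable_holds`, a theorem of
  the tree) the Pochhammer–Wilkinson polynomials `∏_{k ≤ n} (X − k)` contradict the τ-conjecture at `n = 2^{2^k}`.

References: P. Bürgisser, *On defining integers and proving arithmetic circuit lower bounds*, Comput. Complexity 18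
(2009) 81–103 (= ECCC TR06-113), Thm. 1.1(2), Lemma 2.5, Thm. 2.10, Thm. 2.11, Lemma 2.12, Cor. 3.9, Thm. 4.1(2);
P. Koiran, Comput. Complexity 13 (2004), Thm. 4.3, Thm. 6.1; M. Shub, S. Smale, Duke Math. J. 81 (1995).
-/

set_option linter.dupNamespace false

namespace Summit.ValiantsHypothesis.ValiantsHypothesis.Theorems

open IntegralOrbitsTauBurgisserDet

/-- **`TauBurgisserDet` (crux of route IntegralOrbits): the τ-conjecture excludes quasi-polynomial-size sign
determinantal expressions of every `N · per_n^d`** — Bürgisser 2009, Thm. 1.1(2), re-run at quasi-polynomial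
granularity with powers and an integer multiplier. Boolean side: `stub_perBitsQP`, `stub_chCollapseQP` (with
`stub_tauDetCF`) collapse `CH` to quasi-polynomial circuit size; algebraic side: `stub_transferQP` (from
`stub_transferWitness`, `stub_transferCore`, `stub_tauDetCF`) applied to the `CH`-definable coefficients of the
Pochhammer–Wilkinson polynomials (Cor. 3.9, in tree) bounds `τ(N · (2^e f_n)^d)` quasi-polynomially in `log n`;
`stub_tauEndgame` derives the contradiction with the τ-conjecture. [cite: Burgisser2009, Thm. 1.1(2)] -/
theorem tauBurgisserDet_proof : Summit.ValiantsHypothesis.ValiantsHypothesis.Theses.IntegralOrbits.TauBurgisserDet := by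
  intro hτ hS
  -- Boolean side: `CH ⊆ qpSIZE`
  have hCH := stub_chCollapseQP (stub_perBitsQP stub_tauDetCF hS)
  -- algebraic side at the Pochhammer–Wilkinson coefficients (Cor. 3.9, in tree)
  obtain ⟨c, n₁, hc⟩ := stub_transferQP stub_transferWitness stub_transferCore stub_tauDetCF hS hCH (fun n => n)
    (fun n k => (Literature.Computability.AlgebraicComplexity.pochhammerWilkinson n).coeff k)
    Literature.Computability.AlgebraicComplexity.Burgisser2009_pochhammerWilkinson_coeff_chDefinable_holds
  -- endgame
  refine stub_tauEndgame hτ ⟨c, n₁, fun n hn => ?_⟩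
  obtain ⟨N, e, d, hN, hd, hb⟩ := hc n hn
  refine ⟨N, e, d, hN, hd, ?_⟩
  simpa only [Literature.Computability.AlgebraicComplexity.sum_range_coeff_pochhammerWilkinson] using hb

end Summit.ValiantsHypothesis.ValiantsHypothesis.Theorems
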